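import Summits.MatrixMultiplication.MatrixMultiplication.Theses.LevelGradedCohnUmans
import Literature.RepresentationTheory.FiniteGroups.SymmetricGroupCosetSpanProofs
import Literature.RepresentationTheory.FiniteGroups.SymmetricGroupIsotypic
import Literature.NumberTheory.DiophantineGeometry.SymmetricGroupRepsFinrankSpechtProofs

/-!
# `TokenBudget`: the irreducible characters of `𝔖ₙ` in the `k`-token space are priced by
# the partitions with `μ₁ ≥ n - k`

Route `MatrixMultiplication/LevelGradedCohnUmans`, support item `stmt-MatrixMultiplication-7615`
(`Summit.MatrixMultiplication.MatrixMultiplication.Theses.LevelGradedCohnUmans.TokenBudget`):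
for all `n k : ℕ` and every real `s`,
`∑ᶠ_{χ ∈ Irr(𝔖ₙ) ∩ J_k} (χ 1).re ^ s ≤ ∑_{μ ⊢ n, n - k ≤ μ₁} (f^μ) ^ s`, where
`J_k = {g ↦ ∑_{p : [k] → [n]} c_p (g ∘ p)}` is the `k`-token test space and `f^μ` the number of
standard Young tableaux of shape `μ`.

## Proof

* `J_k ≤ V_k` (`efpV n k` of Ellis–Friedgut–Pilpel, Thm. 7, first half, in the tree's
  group-algebra form): the element `z_f = ∑_σ f(σ) σ` of `f ∈ J_k` is a combination of the token
  class sums `T_{p,q} = ∑_{σ ∘ p = q} σ`; a nonempty `T_{p,q}` is `[Fix (im q)] · π` with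
  `|im q| ≤ k`, and `[Fix C] · x · b_μ = 0` whenever `μ₁ < n - |C|`
  (`fixSum_mul_mul_colAntisymmetrizer_eq_zero`, the transposition trick), so `z_f` kills every
  Specht module `S^μ = ℂ[𝔖ₙ] a_μ b_μ` with `μ₁ < n - k` (`fourierSpecht f μ = 0`).
* The Fourier transform of `χ^μ` at `[μ]` is NOT zero: its trace is
  `∑_σ χ^μ(σ) χ^μ(σ) = ∑_σ χ^μ(σ) χ^μ(σ⁻¹) = |𝔖ₙ|` (`spechtCharacter_inv`, `char_orthonormal`).
* Hence `χ^μ ∈ J_k ⇒ n - k ≤ μ₁`; with `Irr(𝔖ₙ) = {χ^μ}` (`irrChars_perm_eq`, injective in `μ`)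
  and `χ^μ(1) = dim S^μ = f^μ` (`finrank_spechtIdeal_holds`) the finsum is a sub-sum of the
  right-hand side, whose remaining terms `(f^μ)^s` are nonnegative.
-/

-- `Summit.<Summit>.<Problem>` is the tree's mandated summit-side namespace; for this
-- single-conjunct summit the two coincide, so the file silences `dupNamespace`.
set_option linter.dupNamespace false

noncomputable section

open scoped BigOperators
open Literature.RepresentationTheory.FiniteGroups
open Literature.NumberTheory.DiophantineGeometry

namespace Summit.MatrixMultiplication.MatrixMultiplication.Theorems

variable {n k : ℕ}

/-- A nonempty token class is a translate of a pointwise stabiliser: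
`T_{p,q} = ∑_{σ ∘ p = q} σ = [Fix (im q)] · π` for any `π` with `π ∘ p = q`. [folklore] -/
theorem tokenSum_eq_fixSum_mul_of (p q : Fin k → Fin n) {π : Equiv.Perm (Fin n)}
    (hπ : (⇑π ∘ p) = q) :
    ∑ σ ∈ Finset.univ.filter (fun σ : Equiv.Perm (Fin n) => (⇑σ ∘ p) = q),
        MonoidAlgebra.of ℂ _ σ =
      (∑ σ ∈ Finset.univ.filter
          (fun σ : Equiv.Perm (Fin n) => ∀ x ∈ Finset.univ.image q, σ x = x),
        MonoidAlgebra.of ℂ _ σ) * MonoidAlgebra.of ℂ _ π := by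
  classical
  rw [Finset.sum_mul]
  symm
  refine Finset.sum_equiv (Equiv.mulRight π) (fun σ => ?_) (fun σ _ => ?_)
  · simp only [Equiv.coe_mulRight, Finset.mem_filter, Finset.mem_univ, true_and]
    have hπi : ∀ i, π (p i) = q i := fun i => congrFun hπ i
    constructor
    · intro h
      funext i
      rw [Function.comp_apply, Equiv.Perm.mul_apply, hπi]
      exact h (q i) (Finset.mem_image_of_mem q (Finset.mem_univ i))
    · intro h x hx
      obtain ⟨i, -, rfl⟩ := Finset.mem_image.1 hx
      have := congrFun h i
      rw [Function.comp_apply, Equiv.Perm.mul_apply, hπi] at this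
      exact this
  · rw [Equiv.coe_mulRight, map_mul]

/-- **Token class sums kill the Specht modules `S^μ` with `μ₁ < n - k`**: for
`p q : [k] → [n]`, `T_{p,q} · z · b_μ = 0` for every `z ∈ ℂ[𝔖ₙ]` (empty class, or
`T_{p,q} = [Fix (im q)] π` with `|im q| ≤ k` and the transposition trick
`fixSum_mul_mul_colAntisymmetrizer_eq_zero`). [cite: EllisFriedgutPilpel2011, §3.2.3 (proof of Thm. 7)] -/
theorem tokenSum_mul_mul_colAntisymmetrizer_eq_zero (p q : Fin k → Fin n) {μ : Nat.Partition n}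
    (hμ : μ.parts.sup < n - k) (z : MonoidAlgebra ℂ (Equiv.Perm (Fin n))) :
    (∑ σ ∈ Finset.univ.filter (fun σ : Equiv.Perm (Fin n) => (⇑σ ∘ p) = q),
        MonoidAlgebra.of ℂ _ σ) * z * colAntisymmetrizer ℂ μ = 0 := by
  classical
  by_cases hT : ∃ π : Equiv.Perm (Fin n), (⇑π ∘ p) = q
  · obtain ⟨π, hπ⟩ := hT
    have hC : μ.parts.sup < n - (Finset.univ.image q).card := by
      have h1 : (Finset.univ.image q).card ≤ k :=
        Finset.card_image_le.trans (by rw [Finset.card_univ, Fintype.card_fin])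
      omega
    rw [tokenSum_eq_fixSum_mul_of p q hπ, mul_assoc _ (MonoidAlgebra.of ℂ _ π) z]
    exact EllisFriedgutPilpel2011.fixSum_mul_mul_colAntisymmetrizer_eq_zero _ hC _
  · have hempty : Finset.univ.filter (fun σ : Equiv.Perm (Fin n) => (⇑σ ∘ p) = q) = ∅ :=
      Finset.filter_eq_empty_iff.2 fun σ _ h => hT ⟨σ, h⟩
    rw [hempty, Finset.sum_empty, zero_mul, zero_mul]

/-- Token class sums annihilate `S^μ = ℂ[𝔖ₙ] a_μ b_μ` when `μ₁ < n - k`. [cite: EllisFriedgutPilpel2011, §3.2.3 (proof of Thm. 7)] -/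
theorem tokenSum_mul_eq_zero_of_mem_spechtIdeal (p q : Fin k → Fin n) {μ : Nat.Partition n}
    (hμ : μ.parts.sup < n - k) {w : MonoidAlgebra ℂ (Equiv.Perm (Fin n))}
    (hw : w ∈ spechtIdeal ℂ μ) :
    (∑ σ ∈ Finset.univ.filter (fun σ : Equiv.Perm (Fin n) => (⇑σ ∘ p) = q),
        MonoidAlgebra.of ℂ _ σ) * w = 0 := by
  obtain ⟨y, rfl⟩ := Ideal.mem_span_singleton'.1 hw
  rw [youngSymmetrizer, ← mul_assoc y, ← mul_assoc]
  exact tokenSum_mul_mul_colAntisymmetrizer_eq_zero p q hμ _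

/-- The group-algebra element `z_f = ∑_σ f(σ) σ` of a `k`-token function
`f(g) = ∑_p c_p(g ∘ p)` is the combination `∑_p ∑_q c_p(q) T_{p,q}` of token class sums. [folklore] -/
theorem sum_tokenFun_smul_of (c : (Fin k → Fin n) → (Fin k → Fin n) → ℂ)
    (f : Equiv.Perm (Fin n) → ℂ) (hf : ∀ g : Equiv.Perm (Fin n), f g = ∑ p : Fin k → Fin n, c p (⇑g ∘ p)) :
    ∑ σ : Equiv.Perm (Fin n), f σ • MonoidAlgebra.of ℂ _ σ =
      ∑ p : Fin k → Fin n, ∑ q : Fin k → Fin n, c p q •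
        ∑ σ ∈ Finset.univ.filter (fun σ : Equiv.Perm (Fin n) => (⇑σ ∘ p) = q),
          MonoidAlgebra.of ℂ _ σ := by
  classical
  simp_rw [hf, Finset.sum_smul]
  rw [Finset.sum_comm]
  refine Finset.sum_congr rfl fun p _ => ?_
  rw [← Finset.sum_fiberwise Finset.univ (fun σ : Equiv.Perm (Fin n) => (⇑σ ∘ p))
    (fun σ => c p (⇑σ ∘ p) • MonoidAlgebra.of ℂ _ σ)]
  refine Finset.sum_congr rfl fun q _ => ?_
  rw [Finset.smul_sum]
  refine Finset.sum_congr rfl fun σ hσ => ?_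
  rw [(Finset.mem_filter.1 hσ).2]

/-- **`J_k ≤ V_k`**: every `k`-token function `f(g) = ∑_p c_p(g ∘ p)` on `𝔖ₙ` has Fourier
transform vanishing at each `[μ]` with `μ₁ < n - k` (Ellis–Friedgut–Pilpel 2011, Thm. 7, the
inclusion `span{1_T} ≤ V_k`, here for all token classes, injective or not).
[cite: EllisFriedgutPilpel2011, Thm. 7] -/
theorem tokenFun_mem_efpV (c : (Fin k → Fin n) → (Fin k → Fin n) → ℂ)
    (f : Equiv.Perm (Fin n) → ℂ) (hf : ∀ g : Equiv.Perm (Fin n), f g = ∑ p : Fin k → Fin n, c p (⇑g ∘ p)) :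
    f ∈ efpV n k := by
  classical
  rw [mem_efpV_iff]
  intro μ hμ
  apply LinearMap.ext
  intro w
  apply Subtype.ext
  rw [EllisFriedgutPilpel2011.coe_fourierSpecht_apply, LinearMap.zero_apply, Submodule.coe_zero,
    sum_tokenFun_smul_of c f hf, Finset.sum_mul]
  refine Finset.sum_eq_zero fun p _ => ?_
  rw [Finset.sum_mul]
  refine Finset.sum_eq_zero fun q _ => ?_
  rw [smul_mul_assoc, tokenSum_mul_eq_zero_of_mem_spechtIdeal p q hμ w.2, smul_zero]

/-- **The Fourier transform of `χ^μ` at `[μ]` is nonzero**: its trace is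
`∑_σ χ^μ(σ) χ^μ(σ) = ∑_σ χ^μ(σ) χ^μ(σ⁻¹) = |𝔖ₙ| ≠ 0` (Schur orthonormality,
`Representation.char_orthonormal`, and `χ^μ(σ⁻¹) = χ^μ(σ)`). [folklore] -/
theorem fourierSpecht_spechtCharacter_self_ne_zero (μ : Nat.Partition n) :
    fourierSpecht (spechtCharacter ℂ μ) μ ≠ 0 := by
  classical
  intro h0
  have htr := congrArg (LinearMap.trace ℂ (spechtIdeal ℂ μ)) h0
  rw [fourierSpecht, map_sum, map_zero] at htr
  simp only [map_smul, smul_eq_mul] at htr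
  -- `htr : ∑ σ, χ σ * tr (ρ σ) = 0`
  haveI : Invertible (Nat.card (Equiv.Perm (Fin n)) : ℂ) :=
    invertibleOfNonzero (Nat.cast_ne_zero.2 Nat.card_pos.ne')
  haveI : (spechtRep ℂ μ).IsIrreducible := isIrreducible_spechtRep_holds μ
  have horth := Representation.char_orthonormal (spechtRep ℂ μ) (spechtRep ℂ μ)
  rw [if_pos ⟨Representation.Equiv.refl _⟩] at horth
  have hsum : ∑ g : Equiv.Perm (Fin n),
      (spechtRep ℂ μ).character g * (spechtRep ℂ μ).character g⁻¹ = 0 := by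
    rw [← htr]
    refine Finset.sum_congr rfl fun σ _ => ?_
    rw [← spechtCharacter_eq_character, spechtCharacter_inv μ σ, spechtCharacter_apply]
  rw [hsum, mul_zero] at horth
  exact zero_ne_one horth

/-- **Young's rule, pricing direction**: if the Specht character `χ^μ` is a `k`-token function,
then `μ₁ ≥ n - k`. [cite: EllisFriedgutPilpel2011, Thm. 7] -/
theorem sub_le_sup_parts_of_spechtCharacter_tokenFun (μ : Nat.Partition n)
    (c : (Fin k → Fin n) → (Fin k → Fin n) → ℂ)
    (hc : ∀ g : Equiv.Perm (Fin n), spechtCharacter ℂ μ g = ∑ p : Fin k → Fin n, c p (⇑g ∘ p)) :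
    n - k ≤ μ.parts.sup := by
  by_contra hlt
  push Not at hlt
  exact fourierSpecht_spechtCharacter_self_ne_zero μ
    ((mem_efpV_iff _).1 (tokenFun_mem_efpV c _ hc) μ hlt)

/-- `χ^μ(1) = f^μ` (real part form): the degree of the Specht character is the number of
standard Young tableaux (`dim S^μ = f^μ`, `finrank_spechtIdeal_holds`). [folklore] -/
theorem re_spechtCharacter_one (μ : Nat.Partition n) :
    (spechtCharacter ℂ μ 1).re = (numStandardTableaux μ : ℝ) := by
  rw [spechtCharacter_eq_character, Representation.char_one, finrank_spechtIdeal_holds ℂ μ,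
    Complex.natCast_re]

/-- **`TokenBudget`** (route `LevelGradedCohnUmans`, item `stmt-MatrixMultiplication-7615`):
for all `n k` and every real `s`, `∑ᶠ_{χ ∈ Irr(𝔖ₙ) ∩ J_k} χ(1)^s ≤ ∑_{μ ⊢ n, n-k ≤ μ₁} (f^μ)^s` —
every irreducible character in the `k`-token space is a `χ^μ` with `μ₁ ≥ n - k`
(`sub_le_sup_parts_of_spechtCharacter_tokenFun`), distinct characters have distinct `μ`
(`spechtCharacter_injective`), `χ^μ(1) = f^μ`, and the unused terms are `≥ 0`.
[cite: EllisFriedgutPilpel2011, Thm. 7] -/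
theorem tokenBudget_proof :
    Summit.MatrixMultiplication.MatrixMultiplication.Theses.LevelGradedCohnUmans.TokenBudget := by
  intro n k s
  classical
  set J : Set (Equiv.Perm (Fin n) → ℂ) := {f | ∃ c : (Fin k → Fin n) → (Fin k → Fin n) → ℂ,
    ∀ g : Equiv.Perm (Fin n), f g = ∑ p : Fin k → Fin n, c p (⇑g ∘ p)} with hJ
  set T : Set (Nat.Partition n) := {μ | spechtCharacter ℂ μ ∈ J} with hT
  have hset : irrChars (Equiv.Perm (Fin n)) ∩ J =
      (fun μ : Nat.Partition n => spechtCharacter ℂ μ) '' T := by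
    rw [irrChars_perm_eq]
    ext χ
    constructor
    · rintro ⟨⟨μ, rfl⟩, hχ⟩
      exact ⟨μ, hχ, rfl⟩
    · rintro ⟨μ, hμ, rfl⟩
      exact ⟨⟨μ, rfl⟩, hμ⟩
  rw [hset, finsum_mem_image spechtCharacter_injective.injOn, finsum_mem_def,
    finsum_eq_sum_of_fintype]
  refine Finset.sum_le_sum fun μ _ => ?_
  by_cases hμ : μ ∈ T
  · obtain ⟨c, hc⟩ := hμ
    rw [Set.indicator_of_mem (show μ ∈ T from ⟨c, hc⟩),
      if_pos (sub_le_sup_parts_of_spechtCharacter_tokenFun μ c hc), re_spechtCharacter_one]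
  · rw [Set.indicator_of_notMem hμ]
    split_ifs
    · exact Real.rpow_nonneg (Nat.cast_nonneg _) _
    · exact le_rfl

end Summit.MatrixMultiplication.MatrixMultiplication.Theorems

end
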